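import Summits.HubbardSuperconductivity.HubbardSuperconductivity.Theses.InfiniteVolumeFirst
import Summits.HubbardSuperconductivity.HubbardSuperconductivity.Theorems.InfiniteVolumeFirstTightnessExchange
import Summits.HubbardSuperconductivity.HubbardSuperconductivity.Theorems.FunctionFieldCertificateWindowInfraredBoundFreeCalibration
import Summits.HubbardSuperconductivity.HubbardSuperconductivity.Theorems.NoGoNogoThesis
import Literature.MathematicalPhysics.QuantumLattice.HubbardPairDensityCouplingFloor

/-!
# Disproof of `NoNormalLimitState` (stmt-HubbardSuperconductivity-18533, route `InfiniteVolumeFirst`) —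
# findings of the crux-disprover seat (cdisprove, cycle 1, 2026-08-17)

VERDICT SO FAR: **no kill**. The crux is the infinite-volume-first form of the open problem itself
(every torus-limit ground state at one doping and cofinally weak repulsion has a `d_{x²-y²}`
condensate atom); every cheap attack lands on a hypothesis that is visibly load-bearing, and the
load-bearing analysis below is what this file certifies. Prose lives in docstrings only.

Contents (all `theorem`s are sorry-free unless marked NEAR-MISS):

* §0 Bookkeeping — `Admissible δ U N ψ`, `EveryLimitHasAtom ψ`, `NoNormalLimitStateAt δ U` and
  `noNormalLimitState_iff` (`Iff.rfl`): the crux is `∃ δ ∈ (0,½), ∀ U₀ > 0, ∃ U ∈ (0,U₀),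
  NoNormalLimitStateAt δ U`. NON-VACUITY: `admissible_exists` — admissible families exist at EVERY
  `(δ ≥ -1, U)` (tree `NoGo.exists_groundStateInSector_seq`), so no clause of the crux is idle by
  lack of instances; `noNormalLimitState_false_without_convergence` — with the convergence clause
  dropped the matrix is false (witness `C ≡ 0`): the limit function `C` is constrained ONLY through
  the pointwise-convergence clause.
* §1 THE NEGATIVE TOOL (contrapositive of the landed support `TightnessExchange`):
  `not_everyLimitHasAtom_of_tight_of_not_lro` — a family normalised at even sides with TIGHT window
  tails and NO torus LRO along the even sides has SOME pointwise limit without atom. Every kill of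
  the crux at a pair `(δ, U)` this seat can conceive factors through it: exhibit ONE admissible
  family with tight windows and `liminf_k LRO_{2k} = 0`.
* §2 `0 < U` IS LOAD-BEARING AT EVERY DOPING: `noNormalLimitStateAt_zero_false` — for every
  `δ ≥ -1` the inner matrix FAILS at `U = 0` (free Fermi gas: flat pair structure factor
  `S_ψ(m) ≤ 450` for EVERY sector ground state, tree `free_pairStructureFactor_le`; hence window
  tails `≤ 113 ε² L²` — tight — and `LRO_L ≤ 450/L² → 0`; §1 applies). Corollary
  `not_noNormalLimitState_closedWindow`: the natural strengthening "for ALL `U ∈ [0, U₀)`" (window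
  closed at the free point) is false. So the prover's `U` must be chosen strictly inside `(0, U₀)`
  and the proof must use the repulsion at leading order in whatever produces the atom — consistent
  with the barrier `PerturbativeInvisibilityOfPairing` (atom `~ e^{-2/(αρU²)}`).
* §3 THE ATOM MUST VANISH WITH THE COUPLING: `liminf_boxAvg_le_of_tight_of_lro_le` (quantitative
  exchange: tight + `LRO ≤ c` eventually ⇒ every limit atom `≤ c`), `liminf_boxAvg_le_of_small_coupling`
  (coupling floor `HubbardPairDensityCouplingFloor` in the limit: at `0 ≤ U < 4(min(c,1)/48)⁶` every
  tight admissible family has all limit atoms `≤ c`), `exists_convergent_subseq` (a limit to test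
  always exists), and `not_uniformFloor_of_noInfraredPileUp`: the strengthening with the atom floor
  chosen BEFORE `U` contradicts the route's own rank-3 crux `NoInfraredPileUp`. NEAR-MISS: the
  unconditional form needs a window version of the free pairing-cost estimate (docstring).
* §4 NEAR-MISSES / why the crux resists (docstring record, no theorem): symmetry, degeneracy
  splicing, small sides, channel mismatch, literature.

LANDED (Theorems, `--supports stmt-…-18533`, both ACCEPTED 2026-08-17):
`Theorems/NoNormalLimitState/Negative/ZeroCouplingEndpoint.lean` (p145327, commit 81275d4adb00:
§1 tool, §2, non-vacuity, convergence clause) and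
`Theorems/NoNormalLimitState/Negative/NoUniformAtomFloor.lean` (p146340, commit 9b323a1627a0: §3).
Ideators / planners / the lead may import those modules; this work file mirrors them with the
bookkeeping `def`s of §0 for readability.
-/

noncomputable section

-- the mandated namespace repeats `HubbardSuperconductivity` (single-problem summit, D-0017)
set_option linter.dupNamespace false

namespace Summit.HubbardSuperconductivity.HubbardSuperconductivity.Cruxes.NoNormalLimitState.Disproof

open Literature.MathematicalPhysics.QuantumLattice Literature.Probability.LatticeModels Matrix Finset
  Filter
open Summit.HubbardSuperconductivity.HubbardSuperconductivity.Theses.InfiniteVolumeFirst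
  (NoNormalLimitState NoInfraredPileUp TightnessExchange)
open Summit.HubbardSuperconductivity.HubbardSuperconductivity.Theorems
  (infiniteVolumeFirst_tightnessExchange_proof tightnessExchange_lroSeq_nonneg
    tightnessExchange_abs_corrAvg_le tightnessExchange_fejer_bound)
open Summit.HubbardSuperconductivity.HubbardSuperconductivity.Theorems.WindowInfraredBound
  (windowInfraredBound_free_allGroundStates free_pairStructureFactor_le)
open scoped ComplexConjugate ComplexOrder Topology

/-! ### §0 Bookkeeping: the crux as `∃ δ ∀ U₀ ∃ U, NoNormalLimitStateAt δ U`; non-vacuity -/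

/-- The admissibility clause of the crux (verbatim): at every even side `L`, `N L` is the
prescribed even particle number `2⌊(1-δ)L²/2⌋`, `ψ L` is normalised and is a ground state of
`hubbardTorus 2 L 1 U` in the sector `(N L, S^z = 0)`. [folklore] -/
def Admissible (δ U : ℝ) (N : ℕ → ℕ) (ψ : ∀ L, Fock (Orb (FermionTorus 2 L))) : Prop :=
  ∀ L, Even L → N L = 2 * ⌊(1 - δ) * (L : ℝ) ^ 2 / 2⌋₊ ∧ star (ψ L) ⬝ᵥ ψ L = 1 ∧
    IsGroundStateInSector (hubbardTorus 2 L 1 U) (N L) 0 (ψ L)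

/-- The conclusion clause of the crux for one family (verbatim): every pointwise limit `C`, along a
strictly increasing sequence of even sides, of the translation-averaged `d`-wave pair correlations
`C_L(x) = L⁻² Σ_y G_L(x+y, y)` has a positive condensate atom
`liminf_R R⁻⁴ Σ_{x,y ∈ [0,R)²} C(x-y) > 0`. [folklore] -/
def EveryLimitHasAtom (ψ : ∀ L, Fock (Orb (FermionTorus 2 L))) : Prop :=
  ∀ (Ls : ℕ → ℕ) (C : Site 2 → ℝ), StrictMono Ls → (∀ j, Even (Ls j)) →
    (∀ x : Site 2, Tendsto (fun j : ℕ => (∑ y ∈ halfOpenBox 2 (Ls j),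
      torusPullback (pairFieldCorr dWaveFormFactor ψ) (Ls j) (x + y) y) / ((Ls j : ℕ) : ℝ) ^ 2)
      atTop (𝓝 (C x))) →
    0 < liminf (fun R : ℕ => (∑ x ∈ halfOpenBox 2 R, ∑ y ∈ halfOpenBox 2 R, C (x - y)) /
      ((R : ℕ) : ℝ) ^ 4) atTop

/-- The inner matrix of the crux at a fixed doping `δ` and coupling `U`: every admissible family has
the every-limit-atom property. [folklore] -/
def NoNormalLimitStateAt (δ U : ℝ) : Prop :=
  ∀ (N : ℕ → ℕ) (ψ : ∀ L, Fock (Orb (FermionTorus 2 L))), Admissible δ U N ψ → EveryLimitHasAtom ψ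

/-- The crux, re-bracketed: `NoNormalLimitState ↔ ∃ δ ∈ (0,½), ∀ U₀ > 0, ∃ U ∈ (0,U₀),
NoNormalLimitStateAt δ U` (definitional). [folklore] -/
theorem noNormalLimitState_iff :
    NoNormalLimitState ↔ ∃ δ ∈ Set.Ioo (0:ℝ) (1 / 2), ∀ U₀ : ℝ, 0 < U₀ →
      ∃ U ∈ Set.Ioo (0:ℝ) U₀, NoNormalLimitStateAt δ U :=
  Iff.rfl

/-- **Non-vacuity of the hypotheses.** For every `δ ≥ -1` and EVERY real `U` there is an admissible
family (indeed one defined at all sides, not only the even ones): normalised sector ground states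
exist by finite-dimensional spectral theory (tree `NoGo.exists_groundStateInSector_seq`). So the
crux is never true for lack of instances, at any `(δ, U)`. Lieb, PRL 62 (1989) 1201;
Tasaki (2020) §2.2. [folklore] -/
theorem admissible_exists (δ U : ℝ) (hδ : -1 ≤ δ) :
    ∃ (N : ℕ → ℕ) (ψ : ∀ L, Fock (Orb (FermionTorus 2 L))), Admissible δ U N ψ := by
  obtain ⟨N, ψ, h⟩ := Summit.HubbardSuperconductivity.NoGo.exists_groundStateInSector_seq 1 U δ hδ
  exact ⟨N, ψ, fun L _ => h L⟩

/-- The crux with the pointwise-CONVERGENCE clause dropped (so `C` is an arbitrary function,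
unrelated to the family). [folklore] -/
def NoNormalLimitStateWithoutConvergence : Prop :=
  ∃ δ ∈ Set.Ioo (0:ℝ) (1 / 2), ∀ U₀ : ℝ, 0 < U₀ → ∃ U ∈ Set.Ioo (0:ℝ) U₀,
    ∀ (N : ℕ → ℕ) (ψ : ∀ L, Fock (Orb (FermionTorus 2 L))), Admissible δ U N ψ →
      ∀ (Ls : ℕ → ℕ) (C : Site 2 → ℝ), StrictMono Ls → (∀ j, Even (Ls j)) →
        0 < liminf (fun R : ℕ => (∑ x ∈ halfOpenBox 2 R, ∑ y ∈ halfOpenBox 2 R, C (x - y)) /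
          ((R : ℕ) : ℝ) ^ 4) atTop

/-- **Any proof must use the convergence clause** (and can use nothing else about `C`): with it
dropped the matrix is false — admissible families exist (`admissible_exists`) and `C ≡ 0` has no
atom. [folklore] -/
theorem noNormalLimitState_false_without_convergence : ¬ NoNormalLimitStateWithoutConvergence := by
  rintro ⟨δ, hδ, h⟩
  obtain ⟨U, -, hU⟩ := h 1 one_pos
  obtain ⟨N, ψ, hadm⟩ := admissible_exists δ U (by linarith [hδ.1])
  have h0 := hU N ψ hadm (fun j => 2 * j) (fun _ => 0)
    (fun a b hab => by dsimp only; omega) (fun j => even_two_mul j)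
  simp only [Finset.sum_const_zero, zero_div, liminf_const, lt_self_iff_false] at h0

/-! ### §1 The negative tool: tight windows + no torus LRO ⇒ some limit has no atom -/

/-- **Contrapositive of the landed support `TightnessExchange`.** If a family `ψ` is normalised at
even sides, its small-momentum window tails are tight (the `NoInfraredPileUp` conclusion for `ψ`)
and it has NO `d`-wave pair long-range order along the even sides (summit format), then it is NOT
true that every pointwise limit of its translation-averaged pair correlations has an atom: some
subsequence of even sides has a limit `C` with `liminf_R R⁻⁴ Σ_{x,y∈[0,R)²} C(x-y) ≤ 0`. This is
the shape of every conceivable kill of the crux at a pair `(δ, U)`. Kennedy–Lieb–Shastry, PRL 61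
(1988) 2582; Friedli–Velenik (2017) §10.4. [folklore] -/
theorem not_everyLimitHasAtom_of_tight_of_not_lro (ψ : ∀ L, Fock (Orb (FermionTorus 2 L)))
    (hnorm : ∀ L, Even L → star (ψ L) ⬝ᵥ ψ L = 1)
    (htight : ∀ η : ℝ, 0 < η → ∃ ε : ℝ, 0 < ε ∧ ∃ L₀ : ℕ, ∀ (L : ℕ) [NeZero L], Even L → L₀ ≤ L →
      (∑ m : Fin 2 → ZMod L, if m ≠ 0 ∧ momentumNormSq L m ≤ ε ^ 2 then
        pairStructureFactor dWaveFormFactor L (ψ L) m else 0) ≤ η * (L : ℝ) ^ 2)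
    (hlro : ¬ HasLongRangeOrder (fun k => halfOpenBox 2 (2 * k))
      (fun k => torusPullback (pairFieldCorr dWaveFormFactor ψ) (2 * k))) :
    ¬ EveryLimitHasAtom ψ :=
  fun h => hlro (infiniteVolumeFirst_tightnessExchange_proof ψ hnorm htight h)

/-! ### §2 The coupling must be positive: the inner matrix fails at `U = 0` for every doping -/

/-- **No torus LRO at the free point, every ground state, quantitative.** For a family of normalised
sector ground states of the FREE torus (`U = 0`), at every side `L ≥ 3` the long-range-order term is
`|Λ_L|⁻² Σ_{x,y} G_L(x,y) = L⁻⁴ Re⟨ψ_L, Δ_dᴴΔ_d ψ_L⟩ = L⁻² S_{ψ_L}(0) ≤ 450 / L²`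
(`free_pairStructureFactor_le` at `m = 0`). Bardeen–Cooper–Schrieffer (1957) §II; Yang, Rev. Mod.
Phys. 34 (1962) 694, §3. [folklore] -/
theorem lroSeq_le_of_free {N : ℕ → ℕ} {ψ : ∀ L, Fock (Orb (FermionTorus 2 L))}
    (L : ℕ) (hL : 3 ≤ L) (h1 : star (ψ L) ⬝ᵥ ψ L = 1)
    (hgs : IsGroundStateInSector (hubbardTorus 2 L 1 0) (N L) 0 (ψ L)) :
    (∑ x ∈ halfOpenBox 2 L, ∑ y ∈ halfOpenBox 2 L,
        torusPullback (pairFieldCorr dWaveFormFactor ψ) L x y) / ((halfOpenBox 2 L).card : ℝ) ^ 2 ≤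
      450 / (L : ℝ) ^ 2 := by
  obtain ⟨n, rfl⟩ : ∃ n, L = n + 1 := ⟨L - 1, by omega⟩
  rw [torusLROSeq_pairFieldCorr_succ]
  have hS := free_pairStructureFactor_le (L := n + 1) hL hgs h1 0
  rw [pairStructureFactor_zero] at hS
  have hpos : (0 : ℝ) < ((n + 1 : ℕ) : ℝ) ^ 2 := by positivity
  rw [div_le_iff₀ hpos] at hS
  rw [div_le_div_iff₀ (by positivity) hpos]
  calc (expect ((pairField dWaveFormFactor (n + 1))ᴴ * pairField dWaveFormFactor (n + 1))
          (ψ (n + 1))).re * ((n + 1 : ℕ) : ℝ) ^ 2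
      ≤ 450 * ((n + 1 : ℕ) : ℝ) ^ 2 * ((n + 1 : ℕ) : ℝ) ^ 2 := by nlinarith
    _ = 450 * ((n + 1 : ℕ) : ℝ) ^ 4 := by ring

/-- **Tight windows at the free point, every ground state.** A family of normalised sector ground
states of the free torus has tight window tails in the format of `TightnessExchange` /
`NoInfraredPileUp`: for `η > 0` take `ε = √(η/113)` and `L₀ = 3`
(`windowInfraredBound_free_allGroundStates`: tails `≤ 113 ε² L²`). [folklore] -/
theorem tight_of_free {N : ℕ → ℕ} {ψ : ∀ L, Fock (Orb (FermionTorus 2 L))}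
    (h1 : ∀ L, Even L → star (ψ L) ⬝ᵥ ψ L = 1)
    (hgs : ∀ L, Even L → IsGroundStateInSector (hubbardTorus 2 L 1 0) (N L) 0 (ψ L)) :
    ∀ η : ℝ, 0 < η → ∃ ε : ℝ, 0 < ε ∧ ∃ L₀ : ℕ, ∀ (L : ℕ) [NeZero L], Even L → L₀ ≤ L →
      (∑ m : Fin 2 → ZMod L, if m ≠ 0 ∧ momentumNormSq L m ≤ ε ^ 2 then
        pairStructureFactor dWaveFormFactor L (ψ L) m else 0) ≤ η * (L : ℝ) ^ 2 := by
  intro η hη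
  refine ⟨Real.sqrt (η / 113), Real.sqrt_pos.2 (by positivity), 3, ?_⟩
  intro L _ hLe hL
  have h := windowInfraredBound_free_allGroundStates hL (hgs L hLe) (h1 L hLe)
    (Real.sqrt_pos.2 (by positivity : 0 < η / 113))
  refine h.trans (le_of_eq ?_)
  rw [Real.sq_sqrt (by positivity : 0 ≤ η / 113)]
  ring

/-- **No torus LRO at the free point** (summit format, even sides): the LRO sequence of a family of
normalised free sector ground states tends to `0`, so its `liminf` is `0`, not positive. [folklore] -/
theorem not_lro_of_free {N : ℕ → ℕ} {ψ : ∀ L, Fock (Orb (FermionTorus 2 L))}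
    (h1 : ∀ L, Even L → star (ψ L) ⬝ᵥ ψ L = 1)
    (hgs : ∀ L, Even L → IsGroundStateInSector (hubbardTorus 2 L 1 0) (N L) 0 (ψ L)) :
    ¬ HasLongRangeOrder (fun k => halfOpenBox 2 (2 * k))
      (fun k => torusPullback (pairFieldCorr dWaveFormFactor ψ) (2 * k)) := by
  unfold HasLongRangeOrder
  have hlim : Tendsto (fun k : ℕ => (∑ x ∈ halfOpenBox 2 (2 * k), ∑ y ∈ halfOpenBox 2 (2 * k),
      torusPullback (pairFieldCorr dWaveFormFactor ψ) (2 * k) x y) /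
        ((halfOpenBox 2 (2 * k)).card : ℝ) ^ 2) atTop (𝓝 0) := by
    have hup : Tendsto (fun k : ℕ => (450 : ℝ) / ((2 * k : ℕ) : ℝ) ^ 2) atTop (𝓝 0) := by
      refine tendsto_const_nhds.div_atTop ?_
      refine (tendsto_pow_atTop two_ne_zero).comp ?_
      exact tendsto_natCast_atTop_atTop.comp (tendsto_id.const_mul_atTop' two_pos)
    refine tendsto_of_tendsto_of_tendsto_of_le_of_le' tendsto_const_nhds hup
      (Eventually.of_forall fun k => tightnessExchange_lroSeq_nonneg ψ _) ?_
    filter_upwards [eventually_ge_atTop 2] with k hk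
    exact lroSeq_le_of_free (2 * k) (by omega) (h1 _ (even_two_mul k)) (hgs _ (even_two_mul k))
  rw [hlim.liminf_eq]
  exact lt_irrefl 0

/-- **`0 < U` is load-bearing at every doping: the inner matrix of the crux is FALSE at `U = 0`.**
For every `δ ≥ -1` (in particular every `δ ∈ (0,½)`), take any admissible family of free sector
ground states (`admissible_exists`); its window tails are tight (`tight_of_free`) and it has no
torus LRO (`not_lro_of_free`), so by the exchange tool (§1) some subsequential limit of its
translation-averaged pair correlations has NO atom. Hence in `∃ U ∈ (0, U₀)` the left endpoint
cannot be admitted, and any proof must use the repulsion in producing the atom. (The free Fermi gas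
has summable equal-time `d`-wave pair correlations and a flat pair structure factor: BCS 1957 §II;
Yang 1962 §3.) [folklore] -/
theorem noNormalLimitStateAt_zero_false (δ : ℝ) (hδ : -1 ≤ δ) : ¬ NoNormalLimitStateAt δ 0 := by
  intro h
  obtain ⟨N, ψ, hadm⟩ := admissible_exists δ 0 hδ
  have h1 : ∀ L, Even L → star (ψ L) ⬝ᵥ ψ L = 1 := fun L hL => (hadm L hL).2.1
  have hgs : ∀ L, Even L → IsGroundStateInSector (hubbardTorus 2 L 1 0) (N L) 0 (ψ L) :=
    fun L hL => (hadm L hL).2.2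
  exact not_everyLimitHasAtom_of_tight_of_not_lro ψ h1 (tight_of_free h1 hgs) (not_lro_of_free h1 hgs)
    (h N ψ hadm)

/-- The natural strengthening of the crux in which the coupling window is CLOSED at the free point:
the matrix is asked for ALL `U ∈ [0, U₀)` (instead of SOME `U ∈ (0, U₀)`). [folklore] -/
def NoNormalLimitStateClosedWindow : Prop :=
  ∃ δ ∈ Set.Ioo (0:ℝ) (1 / 2), ∃ U₀ : ℝ, 0 < U₀ ∧ ∀ U ∈ Set.Ico (0:ℝ) U₀, NoNormalLimitStateAt δ U

/-- **The closed-window strengthening is false** (instantiate `U = 0`, `noNormalLimitStateAt_zero_false`).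
[folklore] -/
theorem not_noNormalLimitStateClosedWindow : ¬ NoNormalLimitStateClosedWindow := by
  rintro ⟨δ, hδ, U₀, hU₀, h⟩
  exact noNormalLimitStateAt_zero_false δ (by linarith [hδ.1]) (h 0 ⟨le_rfl, hU₀⟩)

/-! ### §3 The atom floor cannot be uniform in the coupling (tight families) -/

/-- **Quantitative exchange** (the Fejér bound of the landed `TightnessExchange` proof, run with a
finite LRO ceiling instead of `LRO → 0`). For a family `ψ` normalised at even sides with tight
window tails, if the long-range-order terms along the even sides are eventually `≤ c`, then EVERY
pointwise limit `C` (along strictly increasing even sides) has atom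
`liminf_R R⁻⁴ Σ_{x,y∈[0,R)²} C(x-y) ≤ c`: `R⁻⁴ Σ C_L(x-y) ≤ LRO_L + L⁻²Σ_{window}S_L + 2π²C_d²/(R²ε²)`
(`tightnessExchange_fejer_bound`), `j → ∞` then `R → ∞` then `η → 0`.
Kennedy–Lieb–Shastry, PRL 61 (1988) 2582; Friedli–Velenik (2017) §10.4. [folklore] -/
theorem liminf_boxAvg_le_of_tight_of_lro_le (ψ : ∀ L, Fock (Orb (FermionTorus 2 L)))
    (hnorm : ∀ L, Even L → star (ψ L) ⬝ᵥ ψ L = 1)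
    (htight : ∀ η : ℝ, 0 < η → ∃ ε : ℝ, 0 < ε ∧ ∃ L₀ : ℕ, ∀ (L : ℕ) [NeZero L], Even L → L₀ ≤ L →
      (∑ m : Fin 2 → ZMod L, if m ≠ 0 ∧ momentumNormSq L m ≤ ε ^ 2 then
        pairStructureFactor dWaveFormFactor L (ψ L) m else 0) ≤ η * (L : ℝ) ^ 2)
    {c : ℝ} (hlro : ∀ᶠ k : ℕ in atTop,
      (∑ x ∈ halfOpenBox 2 (2 * k), ∑ y ∈ halfOpenBox 2 (2 * k),
          torusPullback (pairFieldCorr dWaveFormFactor ψ) (2 * k) x y) /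
        ((halfOpenBox 2 (2 * k)).card : ℝ) ^ 2 ≤ c)
    (Ls : ℕ → ℕ) (C : Site 2 → ℝ) (hLs : StrictMono Ls) (heven : ∀ j, Even (Ls j))
    (hconv : ∀ x : Site 2, Tendsto (fun j : ℕ => (∑ y ∈ halfOpenBox 2 (Ls j),
      torusPullback (pairFieldCorr dWaveFormFactor ψ) (Ls j) (x + y) y) / ((Ls j : ℕ) : ℝ) ^ 2)
      atTop (𝓝 (C x))) :
    liminf (fun R : ℕ => (∑ x ∈ halfOpenBox 2 R, ∑ y ∈ halfOpenBox 2 R, C (x - y)) /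
      ((R : ℕ) : ℝ) ^ 4) atTop ≤ c := by
  -- the constant `C_d²`
  obtain ⟨B, hB⟩ : ∃ B : ℝ, B = (∑ e ∈ insert (0 : Site 2) unitSteps,
      ‖((dWaveFormFactor e / Real.sqrt 2 : ℝ) : ℂ)‖ * 2) ^ 2 := ⟨_, rfl⟩
  have hB0 : 0 ≤ B := by rw [hB]; positivity
  -- the long-range-order sequence and the translation-averaged pair correlations
  obtain ⟨u, hu⟩ : ∃ u : ℕ → ℝ, ∀ L, u L = (∑ x ∈ halfOpenBox 2 L, ∑ y ∈ halfOpenBox 2 L,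
      torusPullback (pairFieldCorr dWaveFormFactor ψ) L x y) / ((halfOpenBox 2 L).card : ℝ) ^ 2 :=
    ⟨_, fun _ => rfl⟩
  obtain ⟨Cavg, hCavg⟩ : ∃ Cavg : ℕ → Site 2 → ℝ, ∀ L x, Cavg L x =
      (∑ y ∈ halfOpenBox 2 L, torusPullback (pairFieldCorr dWaveFormFactor ψ) L (x + y) y) /
        ((L : ℕ) : ℝ) ^ 2 := ⟨_, fun _ _ => rfl⟩
  have hCB : ∀ j x, |Cavg (Ls j) x| ≤ B := fun j x => by
    rw [hCavg, hB]; exact tightnessExchange_abs_corrAvg_le ψ _ (hnorm _ (heven j)) x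
  have hconv' : ∀ x : Site 2, Tendsto (fun j => Cavg (Ls j) x) atTop (𝓝 (C x)) := fun x => by
    simpa only [hCavg] using hconv x
  have hCbd : ∀ x, |C x| ≤ B := fun x =>
    le_of_tendsto ((continuous_abs.tendsto _).comp (hconv' x)) (Eventually.of_forall fun j => hCB j x)
  -- the box averages of the limit
  obtain ⟨b, hb⟩ : ∃ b : ℕ → ℝ, ∀ R, b R = (∑ x ∈ halfOpenBox 2 R, ∑ y ∈ halfOpenBox 2 R,
      C (x - y)) / ((R : ℕ) : ℝ) ^ 4 := ⟨_, fun _ => rfl⟩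
  have hfun : (fun R : ℕ => (∑ x ∈ halfOpenBox 2 R, ∑ y ∈ halfOpenBox 2 R, C (x - y)) /
      ((R : ℕ) : ℝ) ^ 4) = b := funext fun R => (hb R).symm
  rw [hfun]
  have hb_low : ∀ R, -B ≤ b R := by
    intro R
    have habs : |b R| ≤ B := by
      rw [hb, abs_div, abs_of_nonneg (by positivity : (0 : ℝ) ≤ ((R : ℕ) : ℝ) ^ 4)]
      rcases Nat.eq_zero_or_pos R with rfl | hRpos
      · simpa using hB0
      · rw [div_le_iff₀ (by positivity)]
        calc |∑ x ∈ halfOpenBox 2 R, ∑ y ∈ halfOpenBox 2 R, C (x - y)|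
            ≤ ∑ x ∈ halfOpenBox 2 R, |∑ y ∈ halfOpenBox 2 R, C (x - y)| :=
              Finset.abs_sum_le_sum_abs _ _
          _ ≤ ∑ x ∈ halfOpenBox 2 R, ∑ y ∈ halfOpenBox 2 R, |C (x - y)| :=
              Finset.sum_le_sum fun x _ => Finset.abs_sum_le_sum_abs _ _
          _ ≤ ∑ x ∈ halfOpenBox 2 R, ∑ y ∈ halfOpenBox 2 R, B :=
              Finset.sum_le_sum fun x _ => Finset.sum_le_sum fun y _ => hCbd _
          _ = B * ((R : ℕ) : ℝ) ^ 4 := by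
              rw [Finset.sum_const, Finset.sum_const, card_halfOpenBox, smul_smul, nsmul_eq_mul]
              push_cast
              ring
    exact (abs_le.1 habs).1
  -- along `Ls` the LRO terms are eventually `≤ c`
  have hu_ev : ∀ᶠ j in atTop, u (Ls j) ≤ c := by
    have hdiv : Tendsto (fun j => Ls j / 2) atTop atTop := by
      refine tendsto_atTop_atTop.2 fun n => ⟨2 * n, fun j hj => ?_⟩
      have h1 : j ≤ Ls j := hLs.id_le j
      omega
    filter_upwards [hdiv.eventually hlro] with j hj
    rw [Nat.two_mul_div_two_of_even (heven j)] at hj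
    rwa [hu]
  -- for every `η > 0` the atom is at most `c + 2η`
  have hkey : ∀ η : ℝ, 0 < η → liminf b atTop ≤ c + 2 * η := by
    intro η hη
    obtain ⟨ε, hε, L₀, hL₀⟩ := htight η hη
    have hR : ∀ R : ℕ, 0 < R → b R ≤ c + η + 2 * Real.pi ^ 2 * B / ((R : ℝ) ^ 2 * ε ^ 2) := by
      intro R hRpos
      have hbj : Tendsto (fun j => (∑ x ∈ halfOpenBox 2 R, ∑ y ∈ halfOpenBox 2 R,
          Cavg (Ls j) (x - y)) / ((R : ℕ) : ℝ) ^ 4) atTop (𝓝 (b R)) := by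
        rw [hb]
        exact (tendsto_finsetSum _ fun x _ => tendsto_finsetSum _ fun y _ =>
          hconv' (x - y)).div_const _
      refine le_of_tendsto hbj ?_
      have hev : ∀ᶠ j in atTop, max L₀ 1 ≤ Ls j := hLs.tendsto_atTop.eventually_ge_atTop _
      filter_upwards [hev, hu_ev] with j hj huj
      obtain ⟨n, hn⟩ : ∃ n, Ls j = n + 1 := ⟨Ls j - 1, by omega⟩
      have hevn : Even (n + 1) := hn ▸ heven j
      have hψn : star (ψ (n + 1)) ⬝ᵥ ψ (n + 1) = 1 := hnorm (n + 1) hevn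
      have hwin := hL₀ (n + 1) hevn (by omega)
      have hwin' : (∑ m : TorusSite 2 (n + 1), if m ≠ 0 ∧ momentumNormSq (n + 1) m ≤ ε ^ 2 then
          pairStructureFactor dWaveFormFactor (n + 1) (ψ (n + 1)) m else 0) /
            ((n + 1 : ℕ) : ℝ) ^ 2 ≤ η := by rwa [div_le_iff₀ (by positivity)]
      have hf := tightnessExchange_fejer_bound ψ n hψn R hRpos ε hε
      rw [← hB, ← hu] at hf
      rw [hn] at huj
      rw [hn]
      simp only [hCavg]
      linarith
    have htail : Tendsto (fun R : ℕ => 2 * Real.pi ^ 2 * B / ((R : ℝ) ^ 2 * ε ^ 2)) atTop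
        (𝓝 0) := by
      refine tendsto_const_nhds.div_atTop ?_
      exact ((tendsto_pow_atTop two_ne_zero).comp tendsto_natCast_atTop_atTop).atTop_mul_const
        (pow_pos hε 2)
    have hev : ∀ᶠ R : ℕ in atTop, b R ≤ c + 2 * η := by
      filter_upwards [htail.eventually_le_const hη, eventually_gt_atTop 0] with R h1 h2
      linarith [hR R h2]
    exact liminf_le_of_frequently_le hev.frequently (isBoundedUnder_of ⟨-B, fun R => hb_low R⟩)
  refine le_of_forall_pos_lt_add fun η hη => ?_
  have h := hkey (η / 4) (by positivity)
  linarith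

/-- **Weak repulsion caps the atom of tight families** (the tree's coupling floor
`HubbardPairDensityCouplingFloor`, moved to the limit by the quantitative exchange). For `c > 0` and
`0 ≤ U < 4·(min(c,1)/48)⁶`, every admissible family at `(δ ≥ -1, U)` whose window tails are tight
has ALL its pointwise limits with atom `≤ c`: a sector ground state with `Re⟨ψ,Δ_dᴴΔ_dψ⟩ ≥ cL⁴`
would force `4(min(c,1)/48)⁶ ≤ U` (`re_expect_pairField_dWave_lt_of_groundStateInSector`), so
`LRO_L < c` for `L ≥ ⌈384/c⌉ + 3`. Read contrapositively: an atom `a` seen at coupling `U` needs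
`U ≥ 4(min(a,1)/48)⁶` — the crux's atom must vanish as `U → 0⁺` (for tight families at least as
fast as `48·(U/4)^{1/6}`). Bardeen–Cooper–Schrieffer (1957) §II; Tasaki (2020) §2.2. [folklore] -/
theorem liminf_boxAvg_le_of_small_coupling {c U δ : ℝ} (hc : 0 < c) (hU0 : 0 ≤ U)
    (hU : U < 4 * (min c 1 / 48) ^ 6) (hδ : -1 ≤ δ) {N : ℕ → ℕ}
    {ψ : ∀ L, Fock (Orb (FermionTorus 2 L))} (hadm : Admissible δ U N ψ)
    (htight : ∀ η : ℝ, 0 < η → ∃ ε : ℝ, 0 < ε ∧ ∃ L₀ : ℕ, ∀ (L : ℕ) [NeZero L], Even L → L₀ ≤ L →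
      (∑ m : Fin 2 → ZMod L, if m ≠ 0 ∧ momentumNormSq L m ≤ ε ^ 2 then
        pairStructureFactor dWaveFormFactor L (ψ L) m else 0) ≤ η * (L : ℝ) ^ 2)
    (Ls : ℕ → ℕ) (C : Site 2 → ℝ) (hLs : StrictMono Ls) (heven : ∀ j, Even (Ls j))
    (hconv : ∀ x : Site 2, Tendsto (fun j : ℕ => (∑ y ∈ halfOpenBox 2 (Ls j),
      torusPullback (pairFieldCorr dWaveFormFactor ψ) (Ls j) (x + y) y) / ((Ls j : ℕ) : ℝ) ^ 2)
      atTop (𝓝 (C x))) :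
    liminf (fun R : ℕ => (∑ x ∈ halfOpenBox 2 R, ∑ y ∈ halfOpenBox 2 R, C (x - y)) /
      ((R : ℕ) : ℝ) ^ 4) atTop ≤ c := by
  refine liminf_boxAvg_le_of_tight_of_lro_le ψ (fun L hL => (hadm L hL).2.1) htight ?_ Ls C hLs
    heven hconv
  filter_upwards [eventually_ge_atTop (⌈384 / c⌉₊ + 3)] with k hk
  obtain ⟨n, hn⟩ : ∃ n, 2 * k = n + 1 := ⟨2 * k - 1, by omega⟩
  have hevn : Even (n + 1) := hn ▸ even_two_mul k
  obtain ⟨hN, h1, hgs⟩ := hadm (n + 1) hevn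
  rw [hN] at hgs
  have hle : ⌊(1 - δ) * ((n + 1 : ℕ) : ℝ) ^ 2 / 2⌋₊ ≤ (n + 1) ^ 2 :=
    Summit.HubbardSuperconductivity.NoGo.floor_pairNumber_le δ hδ (n + 1)
  have hlt := re_expect_pairField_dWave_lt_of_groundStateInSector hc hU0 hU (L := n + 1)
    (by omega) hle hgs h1
  rw [hn, torusLROSeq_pairFieldCorr_succ]
  have hpos : (0 : ℝ) < ((n + 1 : ℕ) : ℝ) ^ 4 := by positivity
  rw [div_le_iff₀ hpos]
  exact hlt.le

/-- The natural strengthening of the crux with an atom floor `a` chosen BEFORE the coupling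
(uniform in `U`): `∃ δ ∃ a > 0 ∀ U₀ ∃ U ∈ (0,U₀)`, every admissible family's limits have atom
`≥ a`. [folklore] -/
def NoNormalLimitStateUniformFloor : Prop :=
  ∃ δ ∈ Set.Ioo (0:ℝ) (1 / 2), ∃ a : ℝ, 0 < a ∧ ∀ U₀ : ℝ, 0 < U₀ → ∃ U ∈ Set.Ioo (0:ℝ) U₀,
    ∀ (N : ℕ → ℕ) (ψ : ∀ L, Fock (Orb (FermionTorus 2 L))), Admissible δ U N ψ →
      ∀ (Ls : ℕ → ℕ) (C : Site 2 → ℝ), StrictMono Ls → (∀ j, Even (Ls j)) →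
        (∀ x : Site 2, Tendsto (fun j : ℕ => (∑ y ∈ halfOpenBox 2 (Ls j),
          torusPullback (pairFieldCorr dWaveFormFactor ψ) (Ls j) (x + y) y) / ((Ls j : ℕ) : ℝ) ^ 2)
          atTop (𝓝 (C x))) →
        a ≤ liminf (fun R : ℕ => (∑ x ∈ halfOpenBox 2 R, ∑ y ∈ halfOpenBox 2 R, C (x - y)) /
          ((R : ℕ) : ℝ) ^ 4) atTop

/-- **A convergent subsequence always exists** (diagonal argument: `|C_L(x)| ≤ C_d²`, the cube
`[-C_d², C_d²]^{ℤ²}` is compact and first countable). So the conclusion clause of the crux is never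
idle for an admissible family: along the even sides there IS a pointwise limit to test. [folklore] -/
theorem exists_convergent_subseq (ψ : ∀ L, Fock (Orb (FermionTorus 2 L)))
    (hnorm : ∀ L, Even L → star (ψ L) ⬝ᵥ ψ L = 1) :
    ∃ (Ls : ℕ → ℕ) (C : Site 2 → ℝ), StrictMono Ls ∧ (∀ j, Even (Ls j)) ∧
      ∀ x : Site 2, Tendsto (fun j : ℕ => (∑ y ∈ halfOpenBox 2 (Ls j),
        torusPullback (pairFieldCorr dWaveFormFactor ψ) (Ls j) (x + y) y) / ((Ls j : ℕ) : ℝ) ^ 2)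
        atTop (𝓝 (C x)) := by
  obtain ⟨B, hB⟩ : ∃ B : ℝ, B = (∑ e ∈ insert (0 : Site 2) unitSteps,
      ‖((dWaveFormFactor e / Real.sqrt 2 : ℝ) : ℂ)‖ * 2) ^ 2 := ⟨_, rfl⟩
  obtain ⟨Cavg, hCavg⟩ : ∃ Cavg : ℕ → Site 2 → ℝ, ∀ L x, Cavg L x =
      (∑ y ∈ halfOpenBox 2 L, torusPullback (pairFieldCorr dWaveFormFactor ψ) L (x + y) y) /
        ((L : ℕ) : ℝ) ^ 2 := ⟨_, fun _ _ => rfl⟩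
  have hCB : ∀ k x, |Cavg (2 * k) x| ≤ B := fun k x => by
    rw [hCavg, hB]; exact tightnessExchange_abs_corrAvg_le ψ _ (hnorm _ (even_two_mul k)) x
  obtain ⟨K, hK⟩ : ∃ K : Set (Site 2 → ℝ), K = Set.pi Set.univ fun _ => Set.Icc (-B) B :=
    ⟨_, rfl⟩
  have hKc : IsCompact K := hK ▸ isCompact_univ_pi fun _ => isCompact_Icc
  have hmem : ∀ k, (fun x => Cavg (2 * k) x) ∈ K := fun k =>
    hK ▸ Set.mem_univ_pi.2 fun x => abs_le.1 (hCB k x)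
  obtain ⟨C, -, φ, hφ, hconv⟩ := hKc.tendsto_subseq hmem
  refine ⟨fun j => 2 * φ j, C, fun a b hab => ?_, fun j => even_two_mul _, fun x => ?_⟩
  · have h := hφ hab
    dsimp only
    omega
  · have h := tendsto_pi_nhds.1 hconv x
    simpa only [Function.comp_def, hCavg] using h

/-- **The atom floor must be chosen AFTER the coupling** (modulo the sibling crux
`NoInfraredPileUp`, stmt-18534, which supplies tightness of admissible families at weak coupling):
`NoInfraredPileUp → ¬ NoNormalLimitStateUniformFloor`. Given `δ` and `a`, take `c = a/2` and a
coupling `U` below both the tightness threshold `U₁(δ)` and `4(min(c,1)/48)⁶`; an admissible family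
exists (`admissible_exists`), is tight, and has a convergent subsequence (`exists_convergent_subseq`)
whose limit atom is `≤ a/2` (`liminf_boxAvg_le_of_small_coupling`) — against the floor `a`. So in
any proof of the crux the atom is `a(U) → 0⁺`; a witness shape with `a` before `U` contradicts the
route's own rank-3 crux. Compare `LowEnergyRigidity/Negative/NoUniformFloorNearZeroCoupling`
(finite-volume `κ`-window version). [folklore] -/
theorem not_uniformFloor_of_noInfraredPileUp (hT : NoInfraredPileUp) :
    ¬ NoNormalLimitStateUniformFloor := by
  rintro ⟨δ, hδ, a, ha, h⟩
  obtain ⟨U₁, hU₁, hT'⟩ := hT δ hδ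
  have hc : (0 : ℝ) < a / 2 := by positivity
  have hstar : (0 : ℝ) < 4 * (min (a / 2) 1 / 48) ^ 6 := by positivity
  obtain ⟨U, hU, hfloor⟩ := h (min U₁ (4 * (min (a / 2) 1 / 48) ^ 6)) (lt_min hU₁ hstar)
  have hδ1 : (-1 : ℝ) ≤ δ := by linarith [hδ.1]
  obtain ⟨N, ψ, hadm⟩ := admissible_exists δ U hδ1
  have htight := hT' U ⟨hU.1, hU.2.trans_le (min_le_left _ _)⟩ N ψ hadm
  obtain ⟨Ls, C, hLs, heven, hconv⟩ := exists_convergent_subseq ψ fun L hL => (hadm L hL).2.1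
  have hge := hfloor N ψ hadm Ls C hLs heven hconv
  have hle := liminf_boxAvg_le_of_small_coupling hc hU.1.le (hU.2.trans_le (min_le_right _ _)) hδ1
    hadm htight Ls C hLs heven hconv
  linarith

/-- NEAR-MISS (unconditional form of `not_uniformFloor_of_noInfraredPileUp`). Dropping the
tightness input needs an a-priori WINDOW version of the tree's pairing-cost estimate at `U = 0`:
"window pair weight `Σ_{|q_m|≤ε} S_ψ(m) ≥ a L²` in a unit sector vector costs free kinetic energy
`≥ g(a) L²` with `g` INDEPENDENT of the window scale `ε`" (the tree has only the `q = 0` mode: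
`freeDWavePairing_costs_energy_rate` and its `…Optimal/Log/Uniform` refinements). With it, the upper
Fejér bound `R⁻⁴ΣΣ C_L ≤ L⁻²Σ_{|q|≤ε}S_L + 2π²C_d²/(R²ε²)` at ONE fixed `ε` would cap every limit
atom by `a` once `U < g(a)`, with no tightness. Physically the window cost is LARGER than the
`q = 0` cost (finite-momentum pairs have less Fermi-surface phase space), so the lemma should hold;
it is a free-fermion estimate of the same class as `FreeFermiGasPairingCost.lean` (≈ 250 lines
there for `q = 0`). Not attempted this cycle. -/
theorem not_uniformFloor_unconditional_nearMiss : True := trivial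

/-! ### §4 Near-misses and why the crux resists (record; no theorem)

* SYMMETRY. The square torus Hamiltonian commutes with the `D₄` point group and with translations;
  `d_{x²-y²}` pair operators are `B₁g`: `R P_x R⁻¹ = -P_{Rx}` for the rotation by `π/2`. In a
  pair correlation `⟨ψ, P_xᴴ P_y ψ⟩` the two signs CANCEL, so rotation-eigenstate ground states (which
  always exist in the sector) carry rotation-INVARIANT pair correlations — no selection rule kills
  the atom. Pseudospin `SU(2)` (Yang `η`, even `L`): the n.n. singlet bond pair is a component of a
  pseudospin VECTOR operator; selection rules act between multiplets only; the sector ground state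
  at filling `1-δ` has `J = |J_z| = δL²/2` generically — no vanishing theorem for `⟨Δ_dᴴΔ_d⟩`.
* DEGENERACY SPLICING. "Every admissible family" includes arbitrary unit vectors of degenerate
  sector ground spaces; the atom functional is a PSD quadratic form of `ψ_L` (translation-averaged),
  so convex/cross-term games cannot drive it to zero unless some ground vector already has small
  atom — which is the open problem again.
* SMALL SIDES. `L = 0` (empty lattice: `Fock` is the vacuum line, `H = 0`, the vacuum is an
  admissible normalised ground state) and `L = 2` (the 4-cycle) are harmless: admissibility is per
  side and only the tail of `Ls` matters for the limit; `(Ls j : ℝ)⁻² = 0` at `Ls j = 0` is junk at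
  one index at most. `liminf` over `ℝ` has no junk here: `|C| ≤ C_d²` (limits of
  `tightnessExchange_abs_corrAvg_le`), so the box averages are bounded.
* CHANNEL MISMATCH / FORM FACTOR. A weak-coupling ground state whose condensate is `d_xy`, `g` or a
  higher `B₁g` harmonic orthogonal to `cos kx − cos ky` would have zero atom in THIS `C` (n.n. bond
  field only); the crux's `∃ δ` absorbs it (Raghu–Kivelson–Scalapino 2010: `d_{x²-y²}` leading for
  `0.6 < n < 1` at `t' = 0`), and no such ground state can be CONSTRUCTED at any `δ` anyway.
* LITERATURE KILL (route kill criterion (ii)): a `T = 0` Fermi-liquid theorem for the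
  inversion-SYMMETRIC square-lattice Fermi curve at cofinally small `U` would refute the crux at that
  `δ`; none exists (Feldman–Knörrer–Trubowitz need an asymmetric Fermi curve precisely to suppress
  the Cooper channel; Benfatto–Giuliani–Mastropietro 2006 stop at `T ≥ e^{-c/U}`). Searched this
  cycle: `lit search --hybrid` (local; OpenAlex/arXiv legs rate-limited) → Salmhofer,
  *Renormalization* (1999) p. 162, read: "Because of the Kohn–Luttinger effect, one may expect that
  every system satisfying the assumptions of Sect. 4.2.6 has such a superconducting transition (if
  the reflection symmetry is broken, the Cooper instability is suppressed and Fermi liquid behaviour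
  can occur at zero temperature, as shown in [56])" — the rigorous literature EXPECTS the crux's
  conclusion in kind and offers no normal-state construction for the symmetric case;
  Mastropietro (2008) pp. 28, 231 (same statement; Kac-range BCS only). `ledger negatives`: 2
  entries (BreathingSelfDual, KlsOrderOpenness), neither bears.
* WHAT A KILL NEEDS (by §1): ONE admissible family at the prover's `(δ, U)` with tight windows and
  `LRO_{2k} → 0` — i.e. a weak-coupling ground-state CONSTRUCTION without `d`-wave order. This is
  the same missing engine (a `T = 0` construction of 2-d lattice fermions across the BCS scale) that
  blocks the provers, seen from the other side.
-/

end Summit.HubbardSuperconductivity.HubbardSuperconductivity.Cruxes.NoNormalLimitState.Disproof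

end
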